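import Summits.QuantumFields.BalabanUV.T4Continuum.Support.B13AssemblyCoresEndSubstrateShiftMeasOp
import Summits.QuantumFields.BalabanUV.T4Continuum.Support.B13StepEndInsOpBalaban
import Summits.QuantumFields.BalabanUV.T4Continuum.Support.SubstrateO1ReadingsShiftRate

/-!
# B13AssemblyCoresEndSubstrateShiftBalabanRateUniform — NE5 ∕ U3: ONE CONSTANT FOR EVERY DRIVEN TWO-RUN OBJECT AND EVERY LETTER PACKAGE
# (η-UNIFORMITY AT THE SUBSTRATE's LEVEL-SHIFTED O1 INSTANCE `slotsOfRecordShift`, W-21) ON THE (2.14)-CORES ROAD, W1 PRODUCED AT BAŁABAN's TIER-B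
# BACKGROUND **ON THE RATE ROAD** (substrate-p1's L-E9c `SubstrateO1ReadingsShiftRate` p239614: row NE2's per-background `LocalRate` of the
# coefficient towers + an abstract potential-readings carrier; **NO row NE3 input**, NE5 owner R58), ARITHMETIC LETTERS CHOSEN FROM THE SIZES — the
# η-uniform companion of `B13AssemblyCoresEndSubstrateShiftBalabanRate` (this lineage, same generation), built on this lineage's EXPLICIT-CONSTANT
# face `B13AssemblyCoresEndSubstrateShiftMeasOp.ne5_substrateShift_cores_actNorm` BY NAME; the `_rate` twin of this lineage's S2b (p237336)

Cell `pub-balaban`, unit `b2b-balaban-t4-ne5-formalise-leaf-08` (NE5 formalisation swarm, LEAF PROVER 08, gen 17; the (2.14)-CORES ROAD lineage;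
typer `t4/formal/NE5/LEAVES.md` CLAIM RULE 7 (b)(e) ∕ CLAIM RULE 1; journal INTENT `HOME/CLAIMS.log` l.22637).  WHY THE RE-POINT: as in the
companion module — S2b (p237336) PRODUCES W1 from L-E9b `SubstrateO1ReadingsShift` and so displays node NE3's `NE3Shape (minActReadings …) Cn θ`;
owner R58 (l.22206) ruled that NE5's W1 real window of record is the window of AVERAGING TOWERS of free regular real fine fields, whose two-level
consistency is REGULARITY (row NE2's bridge `NE2FromNE3BavgBridge.localRate_regClass_of_bavg_consistent` ⟹ the per-background binder `LocalRate
(bgReadings L M (regClass L M (liftR L M (RgV V)))) Cn θ` of `B13ReadingsDecay.balaban_twoLevelDecayRate_rate`) — NO row NE3 input to NE5; the owner's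
g38-c `B13ReadingsRecordRate` (p239282) and substrate-p1's W-21c (p239614) put the W1 record face ∕ its O1-letter instance on that RATE ROAD («added
BESIDE W-21b, never edited in», substrate-typer (ο7-2) ∕ (ο9-1)); THIS module is S2b with ONLY the W1 letter block re-pointed: W1 `hwer` := W-21c's
`weightedEntrywiseRate_slotsOfRecordShift_balaban_rate`; `(hθ0 : 0 ≤ θ)` joins the outer SIZES next to `hθ1`; `{BgD ιp Xp : Type*} {dom : Set BgD}
{Rp : Readings ιp Xp}` join the inner ∀ (`𝒞`∕`N` gone, `RgV : BgD → …`); the inner arrow `NE3Shape (minActReadings …) Cn θ →` becomes `(∀ V ∈ dom,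
LocalRate (bgReadings L M (regClass L M (liftR L M (RgV V)))) Cn θ) → LocalRate Rp Cn θ →`; `hQ`∕`hR` read `Rp` — EVERY OTHER BYTE of statement and
proof VERBATIM (generator `HOME/t4/b2b-balaban-t4-ne5-formalise-leaf-08/g17/tools/gen_rate.py`, 17 counted substitutions).  The cov readings stay
WINDOWED to `{k | k ≤ D.K}` (owner R55), the off-window agreement discharged INSIDE W-21c.  Imports this lineage's
`B13AssemblyCoresEndSubstrateShiftMeasOp`, leaf-10-g8's `B13StepEndInsOpBalaban` (for `sqrt_rate_pos_lt_one` ∕ `c1_balaban_nonneg` and, through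
`B13StepEndArithmetic` ∕ `OutputRateArithmetic`, the reach-letter algebra `reach_elim_iff` ∕ `reach_binders_exists` ∕ `smallness_of_gain` BY NAME) and
substrate-p1's `SubstrateO1ReadingsShiftRate` ONLY; edits nothing (S2a ∕ S2b and every earlier module of the road STAY AS LANDED — true roads,
append-only); defines NO species reading (owner RULING R41) and constructs ∕ discharges NOTHING of the instance (DESIGN RULE R34).  Summits-side
new work under the LEAN PLACEMENT RULE (bookkeeping; 0 `def`, 0 cite tags — printed KIND only).  HONEST FRAMING: rung (B)+1 of the FINITE-VOLUME
T⁴ continuum programme — NOT infinite volume, NOT a mass gap, NOT the Clay problem, and **NOT A PROOF OF NE5** (NOT PRINTED: the series prints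
ε-UNIFORM bounds, never η-RATES; cell GAPS G-t4-U3-1), NOT a proof of NE2: the theorem is an IMPLICATION whose wall binders are DISPLAYED
HYPOTHESES about the substrate's letters, its (2.14)-cores of record and row NE2's two rates, asserted nowhere.  R48 ∕ R49 HONEST LINE: the slots of
record are the VALUE-TABLE model (poorer than print at MI-R, [Balaban1988RG2Cluster] Lemma 1 (1.33)); Road D is of record for MI-R, instance =
substrate; VALUE UNCHANGED.  O-8-vol (R54 (3)): block torus at every depth = the final unit torus; printed bounds consumed are volume-uniform.
HONEST DEPENDENCY (cell line, verbatim): continuum YM on T⁴ ⇐ BetaPertH ∧ nine spine estimates (0/9 proved); BetaPertH ⇐ (D1) ∧ (D4) ∧ CAP+tail;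
G-an2-4 gates asym, D1 and NE2/3/4.

WHAT THIS FILE DOES (composition BY NAME; no analytic estimate of its own).  **`uniform_ne5_of_substrateShift_cores_balaban_rate`**: fix the SIZES —
the class ∕ the owner's letters `o, d, L, M, a, α, β, Cn, a′, η, θ, B₁, B₂, B₃, Λ₂, …, Λ₅` (with `0 ≤ θ < 1` — here SIZES, since `C₅` is chosen before
the data), the decay rate `κ ≥ 0`, the anchored exponential norm `0 ≤ Φ′ < 1∕36`, the levels `EA₀, E₀ ≥ 0`, the slice-budget constants `cA, cB ≥ 0`,
the floor `r₀ > 0`, W4's constant `δ′ ≥ 0`, the prescribed rate `√(max θ L⁻¹) ≤ θ′ ≤ 1`, the age damping `0 < ω < 1` — subject to the TWO STRICT SIZE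
INEQUALITIES `cA(EA₀ + E₀) < 1 − ω`, `ω + (Φ′∕(1 − 36Φ′))·cA·(1 − ω)∕(1 − ω − cA(EA₀ + E₀)) < θ′` (unchanged: they contain neither W1's constant nor
the input rate).  The reach letters `ρ₀ < 1`, `k₀`, `B ≥ 0` are then CHOSEN FROM THE SIZES (leaf-10's `reach_elim_iff` ∕ `reach_binders_exists` at the
input rate `Θ := √(max θ L⁻¹)`, `0 < Θ < 1` by `sqrt_rate_pos_lt_one`, W1's constant `c₁ := √(2B₁·2CpertRec∕(1 − Θ²)) + √(2B₂Λ₂CpertRec) +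
√(2B₃Λ₃CpertRec) + Λ₄Cn + Λ₅Cn ≥ 0` by `c1_balaban_nonneg`) and `C₅` is the diamond's closed form `((Φ′∕(1 − 36Φ′)∕(1 − ρ₀))·(c₁∕r₀) + (Φ′∕(1 −
36Φ′)∕(1 − ρ₀))·δ′ + B)·(θ′ − ω)∕(θ′ − (ω + (Φ′∕(1 − 36Φ′)∕(1 − ρ₀))·cA))` — the SAME `C₅` as S2b.  Then for EVERY gauge group, driven two-run object
`D : DrivenRuns 𝔾`, representation `ιr`, letters `cc ag sg`, frame `Pm`, insertion-operator sort `IOp`, factor index data `𝒵 domZ Jc Vv mI`, EVERY letter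
package `Lsl` with `Lsl.ins.ω = ω`, its six letter conditions (p221190 §1, at the shifted slots) and factorisation datum `(iopAt, hiopA)` (p221190 §2),
datum type `BgD`, admissible data `dom ∕ RgV` in the (3.35)-class WITH row NE2's per-background two-level consistency `∀ V ∈ dom, LocalRate (bgReadings …)
Cn θ`, potential-readings carrier `Rp : Readings ιp Xp` WITH `LocalRate Rp Cn θ`, towers over `D`'s run-B backgrounds, O1 letters at the substrate's
SHIFTED tables, window, W3 ×2, L05∕L06, `RawBounded` ×2, floor, W4 at `Θ`, rooms, factor letters `m⋆, mf, bf, N₀f` of the substrate's cores `coresRec` on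
the `measOp`-balls, history radius `H`, stripped majorant `A′` with its decay split and its anchored-norm bound by `Φ′`: the displayed binders IMPLY `NE5
(B13StepOfRecord.outA (slotsOfRecordShift …) E₀ cB) (B13StepOfRecord.outB (slotsOfRecordShift …) E₀ cB) W κ θ′ C₅` — ONE application of `…ShiftMeasOp`
§1 per instance with `hwer` := substrate-p1's `weightedEntrywiseRate_slotsOfRecordShift_balaban_rate`.  The η-UNIFORMITY is the quantifier order `∃ C₅,
∀ 𝔾 D … Lsl …`.  CENSUS vs S2b p237336 (named binders of the statement up to `:=`): MINUS = ∅ among the outer binders, PLUS = {`hθ0`}; in the inner ∀: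
MINUS = {`𝒞`, `N`}, PLUS = {`BgD`, `ιp`, `Xp`, `Rp`}, the unnamed arrow `NE3Shape … →` replaced by the two unnamed arrows above; `dom`∕`RgV`∕the two
potential-Lipschitz arrows CHANGED in type only.  Headline wording (trigger c5 ∕ referee INFO-38): «END ⇐ instance letters», never «leaf instantiated»;
0∕12 leaves on Bałaban's concrete objects; spine 0∕9.  `FlowStep.BetaPertH`, (B), (B^μ) do not occur.  0 sorry; axioms ⊆ {propext, Classical.choice,
Quot.sound}.
-/

noncomputable section

open scoped BigOperators Matrix.Norms.L2Operator
open Metric Set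

namespace Summit.QuantumFields.BalabanUV.T4Continuum.B13AssemblyCoresEndSubstrateShiftBalabanRateUniform

open _root_.MeasureTheory
open Literature.MathematicalPhysics.QuantumFieldTheory.Balaban1983to89
open Literature.MathematicalPhysics.QuantumFieldTheory.Balaban1983to89.T4OutputRate (DecayBound NE5)
open Literature.MathematicalPhysics.QuantumFieldTheory.Balaban1983to89.B5Prop11Plancherel (Tor fine)
open Literature.MathematicalPhysics.QuantumFieldTheory.Balaban1983to89.B5G183RateUnitTower (lev lev_neZero)
open Literature.MathematicalPhysics.QuantumFieldTheory.Balaban1983to89.T4EtaRateMin (Readings LocalRate)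
open Summit.QuantumFields.BalabanUV.T4Continuum
open Summit.QuantumFields.BalabanUV.T4Continuum.B13OpDatum
open Summit.QuantumFields.BalabanUV.T4Continuum.B13OpDatumJunctions (opOf RawBounded WeightedEntrywiseRate)
open Summit.QuantumFields.BalabanUV.T4Continuum.B13OpMeasurable (measOp)
open Summit.QuantumFields.BalabanUV.T4Continuum.B13StepTermLabels (InnerLabel)
open Summit.QuantumFields.BalabanUV.T4Continuum.B13InnerData (Bnd b13InnerData)
open Summit.QuantumFields.BalabanUV.T4Continuum.B13HistMeasurable (MeasPotFrame B13HistM)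
open Summit.QuantumFields.BalabanUV.T4Continuum.B13TermCoreFamily (factorCores)
open Summit.QuantumFields.BalabanUV.T4Continuum.B13TermCoreMass (factorMass)
open Summit.QuantumFields.BalabanUV.T4Continuum.UrsellTreeSum (ind)
open Summit.QuantumFields.BalabanUV.T4Continuum.UrsellTermBudget (actSum)
open Summit.QuantumFields.BalabanUV.T4Continuum.B13DomainGeometryTR (SCube footprint)
open Summit.QuantumFields.BalabanUV.T4Continuum.B13StepOfRecord (assembly step outA outB)
open Summit.QuantumFields.BalabanUV.T4Continuum.B13AssemblyCoresEndRestrictRecord (coresRec)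
open Summit.QuantumFields.BalabanUV.T4Continuum.B13AssemblyCoresEndSubstrateShiftMeasOp (ne5_substrateShift_cores_actNorm)
open Summit.QuantumFields.BalabanUV.T4Continuum.B13StepOfRecordSubstrateShiftLetters (opB_mem_measOp_slotsOfRecordShift)
open Summit.QuantumFields.BalabanUV.T4Continuum.B13StepEndArithmetic (reach_elim_iff smallness_of_gain)
open Summit.QuantumFields.BalabanUV.T4Continuum.OutputRateArithmetic (reach_binders_exists)
open Summit.QuantumFields.BalabanUV.T4Continuum.B13StepEndInsOpBalaban (sqrt_rate_pos_lt_one c1_balaban_nonneg)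
open Summit.QuantumFields.BalabanUV.T4Continuum.B13ReadingsDecay (CovWeightDominatesDist)
open Summit.QuantumFields.BalabanUV.T4Continuum.B13ReadingsLevelWindow (ReadsTowerCovAOn ReadsTowerCovBOn)
open Summit.QuantumFields.BalabanUV.T4Continuum.B13ReadingsImage
open Summit.QuantumFields.BalabanUV.T4Continuum.B13ReadingsLocal (PotQLipschitzReading PotRLipschitzReading)
open Summit.QuantumFields.BalabanUV.T4Continuum.B13ReadingsAssembly (CpertRec)
open Summit.QuantumFields.BalabanUV.T4Continuum.SubstrateO1ReadingsShiftRate (weightedEntrywiseRate_slotsOfRecordShift_balaban_rate)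
open Summit.QuantumFields.BalabanUV.T4Continuum.DecayRateInterpolation (EntryDecay)
open Summit.QuantumFields.BalabanUV.T4Continuum.SubstrateBackgroundTransporters (unitMod)
open Summit.QuantumFields.BalabanUV.T4Continuum.SubstrateTwoRunsDriven (DrivenRuns)
open Summit.QuantumFields.BalabanUV.T4Continuum.SubstrateRawSpecies
open Summit.QuantumFields.BalabanUV.T4Continuum.SubstrateSlotsOfRecord
open Summit.QuantumFields.BalabanUV.T4Continuum.SubstrateSlotsOfRecordShift
open Summit.QuantumFields.BalabanUV.T4Continuum.BalabanAveragedTowerUnit (idx)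
open Summit.QuantumFields.BalabanUV.T4Continuum.GaugeTermScalarData (QuT Q1)
open Summit.QuantumFields.BalabanUV.T4Continuum.RegularSiteTransporters (siteT)
open Summit.QuantumFields.BalabanUV.T4Continuum.RegularBackgroundTower (RegularTransporters regClass)
open Summit.QuantumFields.BalabanUV.T4Continuum.NE2FromNE3 (bgReadings)
open Summit.QuantumFields.BalabanUV.T4Continuum.NE2ColourPerturbedLayer (pertCovC)
open Summit.QuantumFields.BalabanUV.T4Continuum.NE2BalabanRoot (balabanPert)
open Summit.QuantumFields.BalabanUV.T4Continuum.NE2BalabanGauge (gaugeSlot liftR)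
open Summit.QuantumFields.BalabanUV.T4Continuum.NE2BalabanThreshold (etaStar)

section Uniform

variable {d : ℕ} (L : ℕ) [NeZero L] (M : Fin d → ℕ) [hM : ∀ μ, NeZero (M μ)] (a : ℝ) (ha : 0 < a)
variable {o : Type*} [Fintype o] [DecidableEq o] {α β C a' η θ : ℝ} {m : Type*} [Fintype m] [DecidableEq m]

/-- [folklore] **ONE CONSTANT FOR EVERY DRIVEN TWO-RUN OBJECT AND EVERY LETTER PACKAGE (η-UNIFORMITY AT THE SUBSTRATE's LEVEL-SHIFTED O1 INSTANCE)
ON THE (2.14)-CORES ROAD, W1 PRODUCED AT BAŁABAN's TIER-B BACKGROUND ON THE RATE ROAD, REACH LETTERS CHOSEN FROM THE SIZES** — this lineage's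
explicit-constant face `B13AssemblyCoresEndSubstrateShiftMeasOp.ne5_substrateShift_cores_actNorm` (N191 §1 at the shifted slots) applied ONCE per instance,
its `hwer` binder supplied by substrate-p1's W-21c `weightedEntrywiseRate_slotsOfRecordShift_balaban_rate` (row NE2's per-background `LocalRate` + the
potential readings' rate; NO row NE3 input — owner R58), `hc₁ ∕ hθ` by `c1_balaban_nonneg` ∕ `sqrt_rate_pos_lt_one`, `hE₁ := one_pos`, and the reach
letters `ρ₀, k₀, B` (binders `hρ₀ ∕ hnear ∕ hB ∕ hfirst ∕ hsmall`) obtained BEFORE the data from the two strict size inequalities by `reach_elim_iff` ∕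
`reach_binders_exists` ∕ `smallness_of_gain` at the gain `Φ′∕(1 − 36Φ′)`.  See the module docstring for the list of what is fixed outside `∃ C₅` (SIZES,
now including `0 ≤ θ`) and what is quantified inside (EVERYTHING ELSE, now including the datum type `BgD` and the potential-readings carrier `Rp`).
S2b's (p237336) statement with the W1 letter block re-pointed, nothing else; the SAME `C₅`.  NOT a proof of NE5 ∕ NE2: an implication from displayed
binders, the quantifier order `∃ C₅, ∀ 𝔾 D … Lsl …` being the point. -/
theorem uniform_ne5_of_substrateShift_cores_balaban_rate (hL : 2 ≤ L) (hd : 1 ≤ d) (hα : 0 ≤ α) (hβ : 0 ≤ β) (hC : 0 ≤ C) (ha' : 0 < a')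
    (hαη : α ≤ η) (hβη : β ≤ η) (hη : η ≤ etaStar o d a a') {B₁ B₂ B₃ Λ₂ Λ₃ Λ₄ Λ₅ : ℝ} (hΛ₂ : 0 ≤ Λ₂) (hΛ₃ : 0 ≤ Λ₃)
    (hΛ₄ : 0 ≤ Λ₄) (hΛ₅ : 0 ≤ Λ₅) (hθ0 : 0 ≤ θ) (hθ1 : θ < 1) {κ Φ' EA₀ E₀ cA cB r₀ δ' θ' ω : ℝ}
    (hκ : 0 ≤ κ) (hΦ0 : 0 ≤ Φ') (hsmallΦ : 36 * Φ' < 1)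
    (hE₀ : 0 ≤ E₀) (hcA : 0 ≤ cA) (hcB : 0 ≤ cB) (hr₀ : 0 < r₀) (hδ' : 0 ≤ δ')
    (hθθ' : Real.sqrt (max θ ((L : ℝ)⁻¹)) ≤ θ') (hθ'1 : θ' ≤ 1) (hω : 0 < ω) (hω1 : ω < 1)
    (hh : cA * (EA₀ + E₀) < 1 - ω) (hsmall : ω + Φ' / (1 - 36 * Φ') * cA * (1 - ω) / (1 - ω - cA * (EA₀ + E₀)) < θ') :
    ∃ C₅ : ℝ, ∀ {𝔾 : Type} [GaugeGroup 𝔾] (D : DrivenRuns 𝔾) {oc : Type} [Fintype oc] [DecidableEq oc] (ιr : 𝔾 →* Matrix oc oc ℂ) (cc : ℂ)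
      (ag : ℝ) (sg : ℕ → ℂ) {T ι' Sy Ω 𝒴 : Type} [MeasurableSpace Ω] (Pm : MeasPotFrame D.carriers) {IOp : Type*}
      (𝒵 : D.carriers.Dom → InnerLabel D.carriers.Dom (Bnd D.toTwoRuns) → Type) [∀ Z j, Fintype (𝒵 Z j)]
      (domZ : ∀ Z j, 𝒵 Z j → D.carriers.Dom) (Jc : D.carriers.Dom → InnerLabel D.carriers.Dom (Bnd D.toTwoRuns) → Type)
      [∀ Z j, Fintype (Jc Z j)] (Vv : D.carriers.Dom → InnerLabel D.carriers.Dom (Bnd D.toTwoRuns) → Type)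
      [∀ Z j, NormedAddCommGroup (Vv Z j)] [∀ Z j, InnerProductSpace ℝ (Vv Z j)] [∀ Z j, MeasurableSpace (Vv Z j)] [∀ Z j, BorelSpace (Vv Z j)]
      [∀ Z j, FiniteDimensional ℝ (Vv Z j)] (mI : D.carriers.Dom → InnerLabel D.carriers.Dom (Bnd D.toTwoRuns) → Type)
      [∀ Z j, Fintype (mI Z j)] [∀ Z j, DecidableEq (mI Z j)]
      (Lsl : SlotLetters D (o := oc) (T := T) (ι' := ι') (S := Sy) (Ω := Ω) (𝒴 := 𝒴) Pm (IOp := IOp) 𝒵 domZ Jc Vv mI)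
      -- p221190 §1's letter conditions on run B's tables (named: they type the `measOp`-ball centres below) and the factorisation datum's map
      (hbdB : ∀ (g : ℕ → ℝ) (U : D.carriers.BgB) (k : ℕ),
        FormatBounded (Lsl.W k).format (rawBOfRecordShift D ιr cc ag sg Lsl.ΓB Lsl.dkB Lsl.gcB Lsl.pQB Lsl.pRB g U k).kernel)
      (hmQB : ∀ (r : ℝ) (U : GaugeField (D.F.P (D.K + 1)) 0 𝔾) (k : ℕ) (Y : 𝒴) (b b' : ((Tor (unitMod (D.F.P D.K)) × Fin (D.F.P D.K).d) × oc)),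
        Measurable fun x : Ω => Lsl.pQB r U k x Y b b')
      (hmRB : ∀ (r : ℝ) (U : GaugeField (D.F.P (D.K + 1)) 0 𝔾) (k : ℕ) (Y : 𝒴), Measurable fun x : Ω => Lsl.pRB r U k x Y)
      (iopAt : ℝ → D.carriers.BgA → ℕ → IOp)
      {BgD ιp Xp : Type*} {dom : Set BgD} {Rp : Readings ιp Xp}
      {RgV : BgD → ((k : ℕ) → Fin d → (Tor (fine (lev L k) M) → Matrix o o ℂ))}
      {tow : ℕ → (ℕ → ℝ) → D.toTwoRuns.carriers.BgB → ↥dom} {W : Set (ℕ → ℝ)}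
      {σ : T → ((Tor (unitMod (D.F.P D.K)) × Fin (D.F.P D.K).d) × oc) → idx L M 0 × o} {dist₁ : idx L M 0 × o → idx L M 0 × o → ℝ} {δ₁ : ℝ}
      {S₂ : Set (Matrix (idx L M 0 × o) (idx L M 0 × o) ℂ)} {Φ : T → Matrix (idx L M 0 × o) (idx L M 0 × o) ℂ → Matrix m m ℂ}
      {dist₂ : m → m → ℝ} {δ₂ : ℝ} {σX : T → ι' → m}
      {S₃ : Set (Matrix (idx L M 0 × o) (idx L M 0 × o) ℂ)} {Ψ : T → Matrix (idx L M 0 × o) (idx L M 0 × o) ℂ → Matrix m m ℂ}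
      {dist₃ : m → m → ℝ} {δ₃ : ℝ} {σB : T → ((Tor (unitMod (D.F.P D.K)) × Fin (D.F.P D.K).d) × oc) → m}
      {ROp RHist R' H : ℕ → ℝ} {N₀f mf bf : D.carriers.Dom → InnerLabel D.carriers.Dom (Bnd D.toTwoRuns) → ℝ}
      {A' : ℕ → D.carriers.Dom → InnerLabel D.carriers.Dom (Bnd D.toTwoRuns) → ℝ} {mstar : ℝ},
      Lsl.ins.ω = ω →
      -- p221190 §1's letter conditions on run A's tables and the factorisation identity (L01)
      (∀ (g : ℕ → ℝ) (U : D.carriers.BgA) (k : ℕ),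
        FormatBounded (Lsl.W k).format (rawAOfRecord ιr D cc ag sg Lsl.ΓA Lsl.dkA Lsl.gcA Lsl.pQA Lsl.pRA g U k).kernel) →
      (∀ (r : ℝ) (U : GaugeField (D.F.P D.K) 0 𝔾) (k : ℕ) (Y : 𝒴) (b b' : ((Tor (unitMod (D.F.P D.K)) × Fin (D.F.P D.K).d) × oc)),
        Measurable fun x : Ω => Lsl.pQA r U k x Y b b') →
      (∀ (r : ℝ) (U : GaugeField (D.F.P D.K) 0 𝔾) (k : ℕ) (Y : 𝒴), Measurable fun x : Ω => Lsl.pRA r U k x Y) →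
      (∀ (r : ℝ) (U : D.carriers.BgB) (k : ℕ), Lsl.ins.iopA r U k = iopAt r (D.carriers.transport U) k) →
      -- the (3.35)-class, row NE2's per-background two-level consistency of the coefficient towers and the potential readings' rate
      -- (NO row NE3 input, owner R58), the owner's O1 letters at the substrate's tables
      (∀ V ∈ dom, RegularTransporters L M (liftR L M (RgV V)) α β) →
      (∀ V ∈ dom, LocalRate (bgReadings L M (regClass L M (liftR L M (RgV V)))) C θ) →
      LocalRate Rp C θ →
      (∀ V ∈ dom, ∀ k, EntryDecay dist₁
        (pertCovC L M a ha (balabanPert L M a (liftR L M (RgV V)) (gaugeSlot L M (RgV V) (QuT L M o (siteT L M (RgV V))) (Q1 L M o) a'))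
          1 k) B₁ δ₁) →
      ReadsTowerCovAOn {k : ℕ | k ≤ D.K}
        (fun V : ↥dom => pertCovC L M a ha
          (balabanPert L M a (liftR L M (RgV V)) (gaugeSlot L M (RgV V) (QuT L M o (siteT L M (RgV V))) (Q1 L M o) a')) 1)
        σ tow (fun g U k => (rawAOfRecord ιr D cc ag sg Lsl.ΓA Lsl.dkA Lsl.gcA Lsl.pQA Lsl.pRA) g (D.toTwoRuns.carriers.transport U) k) W →
      ReadsTowerCovBOn {k : ℕ | k ≤ D.K}
        (fun V : ↥dom => pertCovC L M a ha
          (balabanPert L M a (liftR L M (RgV V)) (gaugeSlot L M (RgV V) (QuT L M o (siteT L M (RgV V))) (Q1 L M o) a')) 1)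
        σ tow (rawBOfRecordShift D ιr cc ag sg Lsl.ΓB Lsl.dkB Lsl.gcB Lsl.pQB Lsl.pRB) W →
      CovWeightDominatesDist (slotsOfRecordShift D ιr cc ag sg Pm 𝒵 domZ Jc Vv mI Lsl).F dist₁ σ (δ₁ / 2) →
      (∀ t, OpLipschitzOn S₂ (Φ t) Λ₂) →
      (∀ V ∈ dom, ∀ k, pertCovC L M a ha
        (balabanPert L M a (liftR L M (RgV V)) (gaugeSlot L M (RgV V) (QuT L M o (siteT L M (RgV V))) (Q1 L M o) a')) 1 k ∈ S₂) →
      (∀ V ∈ dom, ∀ t k, EntryDecay dist₂ (Φ t (pertCovC L M a ha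
        (balabanPert L M a (liftR L M (RgV V)) (gaugeSlot L M (RgV V) (QuT L M o (siteT L M (RgV V))) (Q1 L M o) a')) 1 k)) B₂ δ₂) →
      ReadsTowerDeltaA (fun (V : ↥dom) t k => Φ t (pertCovC L M a ha
        (balabanPert L M a (liftR L M (RgV V)) (gaugeSlot L M (RgV V) (QuT L M o (siteT L M (RgV V))) (Q1 L M o) a')) 1 k))
        σX tow (fun g U k => (rawAOfRecord ιr D cc ag sg Lsl.ΓA Lsl.dkA Lsl.gcA Lsl.pQA Lsl.pRA) g (D.toTwoRuns.carriers.transport U) k) W →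
      ReadsTowerDeltaB (fun (V : ↥dom) t k => Φ t (pertCovC L M a ha
        (balabanPert L M a (liftR L M (RgV V)) (gaugeSlot L M (RgV V) (QuT L M o (siteT L M (RgV V))) (Q1 L M o) a')) 1 k))
        σX tow (rawBOfRecordShift D ιr cc ag sg Lsl.ΓB Lsl.dkB Lsl.gcB Lsl.pQB Lsl.pRB) W →
      DeltaWeightDominatesDist (slotsOfRecordShift D ιr cc ag sg Pm 𝒵 domZ Jc Vv mI Lsl).F dist₂ σX (δ₂ / 2) →
      (∀ t, OpLipschitzOn S₃ (Ψ t) Λ₃) →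
      (∀ V ∈ dom, ∀ k, pertCovC L M a ha
        (balabanPert L M a (liftR L M (RgV V)) (gaugeSlot L M (RgV V) (QuT L M o (siteT L M (RgV V))) (Q1 L M o) a')) 1 k ∈ S₃) →
      (∀ V ∈ dom, ∀ t k, EntryDecay dist₃ (Ψ t (pertCovC L M a ha
        (balabanPert L M a (liftR L M (RgV V)) (gaugeSlot L M (RgV V) (QuT L M o (siteT L M (RgV V))) (Q1 L M o) a')) 1 k)) B₃ δ₃) →
      ReadsTowerGammaA (fun (V : ↥dom) t k => Ψ t (pertCovC L M a ha
        (balabanPert L M a (liftR L M (RgV V)) (gaugeSlot L M (RgV V) (QuT L M o (siteT L M (RgV V))) (Q1 L M o) a')) 1 k))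
        σB σX tow (fun g U k => (rawAOfRecord ιr D cc ag sg Lsl.ΓA Lsl.dkA Lsl.gcA Lsl.pQA Lsl.pRA) g (D.toTwoRuns.carriers.transport U) k) W →
      ReadsTowerGammaB (fun (V : ↥dom) t k => Ψ t (pertCovC L M a ha
        (balabanPert L M a (liftR L M (RgV V)) (gaugeSlot L M (RgV V) (QuT L M o (siteT L M (RgV V))) (Q1 L M o) a')) 1 k))
        σB σX tow (rawBOfRecordShift D ιr cc ag sg Lsl.ΓB Lsl.dkB Lsl.gcB Lsl.pQB Lsl.pRB) W →
      GammaWeightDominatesDist (slotsOfRecordShift D ιr cc ag sg Pm 𝒵 domZ Jc Vv mI Lsl).F dist₃ σB σX (δ₃ / 2) →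
      PotQLipschitzReading Rp (slotsOfRecordShift D ιr cc ag sg Pm 𝒵 domZ Jc Vv mI Lsl).F
        (fun g U k => (rawAOfRecord ιr D cc ag sg Lsl.ΓA Lsl.dkA Lsl.gcA Lsl.pQA Lsl.pRA) g (D.toTwoRuns.carriers.transport U) k)
        (rawBOfRecordShift D ιr cc ag sg Lsl.ΓB Lsl.dkB Lsl.gcB Lsl.pQB Lsl.pRB) W Λ₄ →
      PotRLipschitzReading Rp (slotsOfRecordShift D ιr cc ag sg Pm 𝒵 domZ Jc Vv mI Lsl).F
        (fun g U k => (rawAOfRecord ιr D cc ag sg Lsl.ΓA Lsl.dkA Lsl.gcA Lsl.pQA Lsl.pRA) g (D.toTwoRuns.carriers.transport U) k)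
        (rawBOfRecordShift D ιr cc ag sg Lsl.ΓB Lsl.dkB Lsl.gcB Lsl.pQB Lsl.pRB) W Λ₅ →
      -- the rest of `…ShiftMeasOp` §1 (p222947 §1 at the shifted slots) at the instance: W3 ×2, L05∕L06, `RawBounded` ×2, floor, W4 at the input rate, rooms, history radius
      (assembly (slotsOfRecordShift D ιr cc ag sg Pm 𝒵 domZ Jc Vv mI Lsl)).SliceBudgetB W κ cB →
      (slotsOfRecordShift D ιr cc ag sg Pm 𝒵 domZ Jc Vv mI Lsl).D.SliceBudget (step (slotsOfRecordShift D ιr cc ag sg Pm 𝒵 domZ Jc Vv mI Lsl) E₀ cB) W κ cA →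
      DecayBound (outA (slotsOfRecordShift D ιr cc ag sg Pm 𝒵 domZ Jc Vv mI Lsl) E₀ cB) W EA₀ κ →
      DecayBound (outB (slotsOfRecordShift D ιr cc ag sg Pm 𝒵 domZ Jc Vv mI Lsl) E₀ cB) W E₀ κ →
      RawBounded (slotsOfRecordShift D ιr cc ag sg Pm 𝒵 domZ Jc Vv mI Lsl).F (assembly (slotsOfRecordShift D ιr cc ag sg Pm 𝒵 domZ Jc Vv mI Lsl)).rawAt W →
      RawBounded (slotsOfRecordShift D ιr cc ag sg Pm 𝒵 domZ Jc Vv mI Lsl).F (slotsOfRecordShift D ιr cc ag sg Pm 𝒵 domZ Jc Vv mI Lsl).rawB W →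
      (∀ k, r₀ ≤ Lsl.rOp k) →
      (step (slotsOfRecordShift D ιr cc ag sg Pm 𝒵 domZ Jc Vv mI Lsl) E₀ cB).InsertionRate W κ E₀ δ' (Real.sqrt (max θ ((L : ℝ)⁻¹))) →
      (∀ k, Lsl.rOp k ≤ ROp k) → (∀ k, ROp k < R' k) →
      (∀ k, (assembly (slotsOfRecordShift D ιr cc ag sg Pm 𝒵 domZ Jc Vv mI Lsl)).bHist E₀ cB k + Lsl.rHist k ≤ RHist k) →
      -- the FACTOR operator letters of the substrate's cores of record on the `measOp`-balls about run B's datum of record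
      0 < mstar → (∀ Z ℓ, mstar ≤ mf Z ℓ) → (∀ Z ℓ, 0 ≤ N₀f Z ℓ) →
      (∀ k, ∀ g ∈ W, ∀ (U : D.carriers.BgB) (X : D.carriers.Dom), D.carriers.scale X = k →
        ∀ i, (assembly (slotsOfRecordShift D ιr cc ag sg Pm 𝒵 domZ Jc Vv mI Lsl)).𝒯.Rel k i X →
        ∀ n : Fin ((assembly (slotsOfRecordShift D ιr cc ag sg Pm 𝒵 domZ Jc Vv mI Lsl)).𝒯.len i + 1),
        (∀ op ∈ ball (⟨opOf (slotsOfRecordShift D ιr cc ag sg Pm 𝒵 domZ Jc Vv mI Lsl).F (slotsOfRecordShift D ιr cc ag sg Pm 𝒵 domZ Jc Vv mI Lsl).rawB g U k,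
            opB_mem_measOp_slotsOfRecordShift D ιr cc ag sg Pm 𝒵 domZ Jc Vv mI Lsl hbdB hmQB hmRB g U k⟩ :
              measOp T ((Tor (unitMod (D.F.P D.K)) × Fin (D.F.P D.K).d) × oc) ι' Ω 𝒴) (R' k),
          AEStronglyMeasurable ((factorCores (assembly (slotsOfRecordShift D ιr cc ag sg Pm 𝒵 domZ Jc Vv mI Lsl)).𝒯 (coresRec D Pm 𝒵 domZ Jc Vv mI Lsl) i n).N
            (op : OpDatum _)) (factorCores (assembly (slotsOfRecordShift D ιr cc ag sg Pm 𝒵 domZ Jc Vv mI Lsl)).𝒯 (coresRec D Pm 𝒵 domZ Jc Vv mI Lsl) i n).lam) ∧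
        (∀ p, DifferentiableOn ℂ (fun op : measOp T ((Tor (unitMod (D.F.P D.K)) × Fin (D.F.P D.K).d) × oc) ι' Ω 𝒴 =>
            (factorCores (assembly (slotsOfRecordShift D ιr cc ag sg Pm 𝒵 domZ Jc Vv mI Lsl)).𝒯 (coresRec D Pm 𝒵 domZ Jc Vv mI Lsl) i n).N (op : OpDatum _) p)
          (ball (⟨opOf (slotsOfRecordShift D ιr cc ag sg Pm 𝒵 domZ Jc Vv mI Lsl).F (slotsOfRecordShift D ιr cc ag sg Pm 𝒵 domZ Jc Vv mI Lsl).rawB g U k,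
            opB_mem_measOp_slotsOfRecordShift D ιr cc ag sg Pm 𝒵 domZ Jc Vv mI Lsl hbdB hmQB hmRB g U k⟩ :
              measOp T ((Tor (unitMod (D.F.P D.K)) × Fin (D.F.P D.K).d) × oc) ι' Ω 𝒴) (R' k))) ∧
        (∀ op ∈ ball (⟨opOf (slotsOfRecordShift D ιr cc ag sg Pm 𝒵 domZ Jc Vv mI Lsl).F (slotsOfRecordShift D ιr cc ag sg Pm 𝒵 domZ Jc Vv mI Lsl).rawB g U k,
            opB_mem_measOp_slotsOfRecordShift D ιr cc ag sg Pm 𝒵 domZ Jc Vv mI Lsl hbdB hmQB hmRB g U k⟩ :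
              measOp T ((Tor (unitMod (D.F.P D.K)) × Fin (D.F.P D.K).d) × oc) ι' Ω 𝒴) (R' k), ∀ p,
          ‖(factorCores (assembly (slotsOfRecordShift D ιr cc ag sg Pm 𝒵 domZ Jc Vv mI Lsl)).𝒯 (coresRec D Pm 𝒵 domZ Jc Vv mI Lsl) i n).N (op : OpDatum _) p‖ ≤
            N₀f ((assembly (slotsOfRecordShift D ιr cc ag sg Pm 𝒵 domZ Jc Vv mI Lsl)).𝒯.poly i n)
              ((assembly (slotsOfRecordShift D ιr cc ag sg Pm 𝒵 domZ Jc Vv mI Lsl)).𝒯.lab i n))) →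
      (∀ k, ∀ g ∈ W, ∀ (U : D.carriers.BgB) (X : D.carriers.Dom), D.carriers.scale X = k →
        ∀ i, (assembly (slotsOfRecordShift D ιr cc ag sg Pm 𝒵 domZ Jc Vv mI Lsl)).𝒯.Rel k i X →
        ∀ n : Fin ((assembly (slotsOfRecordShift D ιr cc ag sg Pm 𝒵 domZ Jc Vv mI Lsl)).𝒯.len i + 1),
        (∀ op ∈ ball (⟨opOf (slotsOfRecordShift D ιr cc ag sg Pm 𝒵 domZ Jc Vv mI Lsl).F (slotsOfRecordShift D ιr cc ag sg Pm 𝒵 domZ Jc Vv mI Lsl).rawB g U k,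
            opB_mem_measOp_slotsOfRecordShift D ιr cc ag sg Pm 𝒵 domZ Jc Vv mI Lsl hbdB hmQB hmRB g U k⟩ :
              measOp T ((Tor (unitMod (D.F.P D.K)) × Fin (D.F.P D.K).d) × oc) ι' Ω 𝒴) (R' k),
          AEStronglyMeasurable (Function.uncurry
            ((factorCores (assembly (slotsOfRecordShift D ιr cc ag sg Pm 𝒵 domZ Jc Vv mI Lsl)).𝒯 (coresRec D Pm 𝒵 domZ Jc Vv mI Lsl) i n).q (op : OpDatum _)))
            ((factorCores (assembly (slotsOfRecordShift D ιr cc ag sg Pm 𝒵 domZ Jc Vv mI Lsl)).𝒯 (coresRec D Pm 𝒵 domZ Jc Vv mI Lsl) i n).lam.prod volume)) ∧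
        (∀ p v, DifferentiableOn ℂ (fun op : measOp T ((Tor (unitMod (D.F.P D.K)) × Fin (D.F.P D.K).d) × oc) ι' Ω 𝒴 =>
            (factorCores (assembly (slotsOfRecordShift D ιr cc ag sg Pm 𝒵 domZ Jc Vv mI Lsl)).𝒯 (coresRec D Pm 𝒵 domZ Jc Vv mI Lsl) i n).q (op : OpDatum _) p v)
          (ball (⟨opOf (slotsOfRecordShift D ιr cc ag sg Pm 𝒵 domZ Jc Vv mI Lsl).F (slotsOfRecordShift D ιr cc ag sg Pm 𝒵 domZ Jc Vv mI Lsl).rawB g U k,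
            opB_mem_measOp_slotsOfRecordShift D ιr cc ag sg Pm 𝒵 domZ Jc Vv mI Lsl hbdB hmQB hmRB g U k⟩ :
              measOp T ((Tor (unitMod (D.F.P D.K)) × Fin (D.F.P D.K).d) × oc) ι' Ω 𝒴) (R' k))) ∧
        (∀ op ∈ ball (⟨opOf (slotsOfRecordShift D ιr cc ag sg Pm 𝒵 domZ Jc Vv mI Lsl).F (slotsOfRecordShift D ιr cc ag sg Pm 𝒵 domZ Jc Vv mI Lsl).rawB g U k,
            opB_mem_measOp_slotsOfRecordShift D ιr cc ag sg Pm 𝒵 domZ Jc Vv mI Lsl hbdB hmQB hmRB g U k⟩ :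
              measOp T ((Tor (unitMod (D.F.P D.K)) × Fin (D.F.P D.K).d) × oc) ι' Ω 𝒴) (R' k), ∀ p v,
          mf ((assembly (slotsOfRecordShift D ιr cc ag sg Pm 𝒵 domZ Jc Vv mI Lsl)).𝒯.poly i n)
              ((assembly (slotsOfRecordShift D ιr cc ag sg Pm 𝒵 domZ Jc Vv mI Lsl)).𝒯.lab i n) * ‖v‖ ^ 2 -
            bf ((assembly (slotsOfRecordShift D ιr cc ag sg Pm 𝒵 domZ Jc Vv mI Lsl)).𝒯.poly i n)
              ((assembly (slotsOfRecordShift D ιr cc ag sg Pm 𝒵 domZ Jc Vv mI Lsl)).𝒯.lab i n) ≤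
            ((factorCores (assembly (slotsOfRecordShift D ιr cc ag sg Pm 𝒵 domZ Jc Vv mI Lsl)).𝒯 (coresRec D Pm 𝒵 domZ Jc Vv mI Lsl) i n).q
              (op : OpDatum _) p v).re)) →
      (∀ k, ∀ g ∈ W, ∀ U : D.carriers.BgB, ‖(assembly (slotsOfRecordShift D ιr cc ag sg Pm 𝒵 domZ Jc Vv mI Lsl)).histRef g U k‖ + RHist k ≤ H k) →
      -- the stripped majorant with its decay split and its anchored exponential norm bounded by `Φ′`
      (∀ k Z ℓ, 0 ≤ A' k Z ℓ) →
      (∀ k Z ℓ, factorMass (coresRec D Pm 𝒵 domZ Jc Vv mI Lsl) N₀f bf mstar (H k) Z ℓ ≤ A' k Z ℓ * Real.exp (-(κ * (D.carriers.d Z + 5)))) →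
      (∀ (k : ℕ) (q : SCube D.toTwoRuns), ∑ Z ∈ D.toTwoRuns.domAt k,
        ind (q ∈ footprint Z) * actSum (b13InnerData D.toTwoRuns) (A' k) k Z * Real.exp ((footprint Z).card) ≤ Φ') →
      NE5 (outA (slotsOfRecordShift D ιr cc ag sg Pm 𝒵 domZ Jc Vv mI Lsl) E₀ cB)
        (outB (slotsOfRecordShift D ιr cc ag sg Pm 𝒵 domZ Jc Vv mI Lsl) E₀ cB) W κ θ' C₅ := by
  obtain ⟨hΘ0, hΘ1⟩ := sqrt_rate_pos_lt_one L hL hθ1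
  have hc₁ : 0 ≤ Real.sqrt (2 * B₁ * (2 * CpertRec o d L a α β C a' / (1 - max θ ((L : ℝ)⁻¹)))) +
      Real.sqrt (2 * B₂ * (Λ₂ * CpertRec o d L a α β C a')) + Real.sqrt (2 * B₃ * (Λ₃ * CpertRec o d L a α β C a')) +
      Λ₄ * C + Λ₅ * C := c1_balaban_nonneg L a hC hΛ₄ hΛ₅
  have hG : 0 ≤ Φ' / (1 - 36 * Φ') := div_nonneg hΦ0 (by linarith)
  obtain ⟨ρ₀, hreach, hρ₀, hs⟩ := (reach_elim_iff (mul_nonneg hG hcA) hω1).mpr ⟨hh, hsmall⟩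
  obtain ⟨k₀, B, hB, hnear, hfirst⟩ := reach_binders_exists
    (D := (Real.sqrt (2 * B₁ * (2 * CpertRec o d L a α β C a' / (1 - max θ ((L : ℝ)⁻¹)))) +
      Real.sqrt (2 * B₂ * (Λ₂ * CpertRec o d L a α β C a')) + Real.sqrt (2 * B₃ * (Λ₃ * CpertRec o d L a α β C a')) +
      Λ₄ * C + Λ₅ * C) / r₀ + δ') (add_nonneg (div_nonneg hc₁ hr₀.le) hδ') hΘ0 hΘ1 hreach
  refine ⟨(Φ' / (1 - 36 * Φ') / (1 - ρ₀) *
      ((Real.sqrt (2 * B₁ * (2 * CpertRec o d L a α β C a' / (1 - max θ ((L : ℝ)⁻¹)))) +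
        Real.sqrt (2 * B₂ * (Λ₂ * CpertRec o d L a α β C a')) + Real.sqrt (2 * B₃ * (Λ₃ * CpertRec o d L a α β C a')) +
        Λ₄ * C + Λ₅ * C) / r₀) + Φ' / (1 - 36 * Φ') / (1 - ρ₀) * δ' + B) * (θ' - ω) /
      (θ' - (ω + Φ' / (1 - 36 * Φ') / (1 - ρ₀) * cA)), ?_⟩
  intro 𝔾 _ D oc _ _ ιr cc ag sg T ι' Sy Ω 𝒴 _ Pm IOp 𝒵 _ domZ Jc _ Vv _ _ _ _ _ mI _ _ Lsl hbdB hmQB hmRB iopAt BgD ιp Xp dom Rp RgV tow W σ dist₁ δ₁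
    S₂    Φ dist₂ δ₂ σX S₃ Ψ dist₃ δ₃ σB ROp RHist R' H N₀f mf bf A' mstar hLω hbdA hmQA hmRA hiopA hreg hloc hRp hdec hcovA hcovB hdom₁ hΦ hS₂ hdecΦ
    hΔA hΔB hdom₂ hΨ hS₃ hdecΨ hΓA hΓB hdom₃ hQ hR hbB hbA hdA hdB hRA hRB hfl hins hOp hroom hHist hm hmf hN₀ hNf hqf hH hA0' hdecM hΦ'
  subst hLω
  have hwer := weightedEntrywiseRate_slotsOfRecordShift_balaban_rate D ιr cc ag sg Pm 𝒵 domZ Jc Vv mI Lsl L M a ha hL hd hreg hα hβ hC hθ0 hθ1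
      hloc hRp ha'
    hαη hβη hη hdec hcovA hcovB hdom₁ hΦ hΛ₂ hS₂ hdecΦ hΔA hΔB hdom₂ hΨ hΛ₃ hS₃ hdecΨ hΓA hΓB hdom₃ hΛ₄ hΛ₅ hQ hR
  exact ne5_substrateShift_cores_actNorm D ιr cc ag sg Pm 𝒵 domZ Jc Vv mI Lsl hbdA hmQA hmRA hbdB hmQB hmRB iopAt hiopA E₀ cB hbB hbA hdA hdB hRA
    hRB hwer hfl hins hOp hroom hHist hm hmf hN₀ hNf hqf hH hκ hA0' hdecM hΦ0 hsmallΦ hΦ' hE₀ one_pos hcA hcB hc₁ hr₀ hδ' hΘ0.le hθθ' hθ'1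
    hω hω1 hρ₀ hnear hB hfirst (smallness_of_gain hs)

end Uniform

end Summit.QuantumFields.BalabanUV.T4Continuum.B13AssemblyCoresEndSubstrateShiftBalabanRateUniform

end
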